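import Literature.Analysis.ODE.LipschitzFlow
import Literature.Analysis.ODE.LiouvilleInvariantMeasure

/-!
# Crux `EnsembleRealization` (stmt-AnomalousDissipation-0215) — line `augmented-lift`,
# sub-stub M1 `stub_augCurrent`, piece (M1b): flow tools (theorems only)

Supports stmt-AnomalousDissipation-0215 (stub `stub_augCurrent` of line `augmented-lift`, piece
M1b `stub_augCurrentPathLawTools`). Nothing here closes an item.

The global flow `Φ t z = lipschitzFlow z t` of a `C¹` compactly supported vector field `V` on a
finite-dimensional space (`Literature.Analysis.ODE.lipschitzFlow`): joint continuity, group
law, confinement of orbits to any set containing `tsupport V`, invariance of every finite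
measure carried by a compact set containing `tsupport V` which satisfies the weak stationary
Liouville equation (`Literature.Analysis.ODE.map_flow_eq_self_of_forall_integral_fderiv_eq_zero`),
and the `L¹`-contraction of time averages along the invariant flow (Tonelli). Packaged as the
single theorem `stub_augCurrentFlowTools`.
-/

noncomputable section

set_option linter.dupNamespace false

open MeasureTheory Set Filter Topology Function Metric
open scoped BigOperators ENNReal NNReal

namespace Summit.AnomalousDissipation.AnomalousDissipation.Theorems.EnsembleRealization

open Literature.Analysis.ODE

variable {E : Type*} [NormedAddCommGroup E] [NormedSpace ℝ E]

/-! ### Orbits of a compactly supported field do not leave a set containing its support -/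

/-- **Confinement.** If `tsupport V ⊆ Bx`, every orbit of the global flow of the Lipschitz
field `V` issued from `Bx` stays in `Bx` (a point outside `tsupport V` is fixed, and the flow is
invertible). -/
theorem lipschitzFlow_mem_of_mem [CompleteSpace E] {V : E → E} {K : ℝ≥0} (hK : LipschitzWith K V)
    {Bx : Set E} (hVB : tsupport V ⊆ Bx) {z : E} (hz : z ∈ Bx) (t : ℝ) :
    lipschitzFlow hK z t ∈ Bx := by
  by_contra h
  have hV0 : V (lipschitzFlow hK z t) = 0 := image_eq_zero_of_notMem_tsupport fun h' => h (hVB h')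
  have hfix := lipschitzFlow_eq_self_of_eq_zero hK hV0 (-t)
  rw [lipschitzFlow_neg_lipschitzFlow] at hfix
  exact h (hfix ▸ hz)

/-! ### Time averages along an invariant jointly measurable semiflow are `L¹`-contractions -/

/-- **Time averages along an invariant semiflow are `L¹`-contractions.** Let `Φ : ℝ → X → X`
be jointly measurable and let the finite measure `m` be invariant under `Φ t` for every
`t ≥ 0`. Then for `0 ≤ q ≤ q'` and an integrable `h`,
`∫ |∫_q^{q'} h (Φ τ x) dτ| dm(x) ≤ (q' − q) · ∫ |h| dm`. -/
theorem integral_abs_intervalIntegral_comp_le {X : Type*} [MeasurableSpace X]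
    {Φ : ℝ → X → X} (hΦ : Measurable fun p : ℝ × X => Φ p.1 p.2)
    (m : Measure X) [IsFiniteMeasure m] (hinv : ∀ t, 0 ≤ t → m.map (Φ t) = m)
    {h : X → ℝ} (hhm : Measurable h) (hh : Integrable h m) {q q' : ℝ} (hq : 0 ≤ q)
    (hqq' : q ≤ q') :
    ∫ x, |∫ τ in q..q', h (Φ τ x)| ∂m ≤ (q' - q) * ∫ x, |h x| ∂m := by
  -- adapted from the wave-2 tool file `StubAugmentedLawCurrentTools.lean` (same session)
  have hG : Measurable fun p : X × ℝ => ‖h (Φ p.2 p.1)‖ₑ :=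
    (hhm.comp (hΦ.comp (measurable_snd.prodMk measurable_fst))).enorm
  have hinner : ∀ τ ∈ Ioc q q', ∫⁻ x, ‖h (Φ τ x)‖ₑ ∂m = ∫⁻ x, ‖h x‖ₑ ∂m := fun τ hτ => by
    have hΦτ : Measurable fun x => Φ τ x := hΦ.comp (measurable_const.prodMk measurable_id)
    rw [← lintegral_map hhm.enorm hΦτ, hinv τ (hq.trans hτ.1.le)]
  have htonelli : ∫⁻ x, (∫⁻ τ in Ioc q q', ‖h (Φ τ x)‖ₑ) ∂m =
      ENNReal.ofReal (q' - q) * ∫⁻ x, ‖h x‖ₑ ∂m := by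
    rw [lintegral_lintegral_swap hG.aemeasurable]
    calc ∫⁻ τ in Ioc q q', (∫⁻ x, ‖h (Φ τ x)‖ₑ ∂m)
        = ∫⁻ τ in Ioc q q', (∫⁻ x, ‖h x‖ₑ ∂m) := setLIntegral_congr_fun measurableSet_Ioc hinner
      _ = ENNReal.ofReal (q' - q) * ∫⁻ x, ‖h x‖ₑ ∂m := by
          rw [setLIntegral_const, Real.volume_Ioc, mul_comm]
  have hfin : ∫⁻ x, (∫⁻ τ in Ioc q q', ‖h (Φ τ x)‖ₑ) ∂m ≠ ∞ := by
    rw [htonelli]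
    exact ENNReal.mul_ne_top ENNReal.ofReal_ne_top hh.2.ne
  have hmeasI : Measurable fun x => ∫⁻ τ in Ioc q q', ‖h (Φ τ x)‖ₑ :=
    Measurable.lintegral_prod_right hG
  have hpt : ∀ x, |∫ τ in q..q', h (Φ τ x)| ≤ (∫⁻ τ in Ioc q q', ‖h (Φ τ x)‖ₑ).toReal := fun x => by
    rw [intervalIntegral.integral_of_le hqq', ← Real.norm_eq_abs]
    refine (norm_integral_le_lintegral_norm _).trans (le_of_eq ?_)
    simp only [ofReal_norm]
  calc ∫ x, |∫ τ in q..q', h (Φ τ x)| ∂m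
      ≤ ∫ x, (∫⁻ τ in Ioc q q', ‖h (Φ τ x)‖ₑ).toReal ∂m :=
        integral_mono_of_nonneg (Eventually.of_forall fun x => abs_nonneg _)
          (integrable_toReal_of_lintegral_ne_top hmeasI.aemeasurable hfin) (Eventually.of_forall hpt)
    _ = (∫⁻ x, (∫⁻ τ in Ioc q q', ‖h (Φ τ x)‖ₑ) ∂m).toReal :=
        integral_toReal hmeasI.aemeasurable (ae_lt_top hmeasI hfin)
    _ = (q' - q) * ∫ x, |h x| ∂m := by
        rw [htonelli, ENNReal.toReal_mul, ENNReal.toReal_ofReal (sub_nonneg.2 hqq')]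
        simp_rw [← Real.norm_eq_abs]
        rw [integral_norm_eq_lintegral_enorm hh.1]

/-! ### The packaged flow tools -/

/-- **Flow tools for (M1b).** For a `C¹` compactly supported field `V` on a finite-dimensional
space, a compact `Bx ⊇ tsupport V` and a finite measure `m` carried by `Bx` satisfying the weak
stationary Liouville equation `∫ Dψ(z)[V z] dm = 0` (`ψ ∈ C¹_c`), the global flow `Φ` of `V`
is jointly continuous, starts at the identity, solves the ODE, has the group law, keeps `Bx`
invariant, PRESERVES `m` (`(Φ t)_* m = m`, `t ≥ 0`); continuous observables are `m`-integrable,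
their time integrals along the flow depend continuously on the starting point, and their time
averages are `L¹(m)`-contractions: `∫ |∫_q^{q'} h (Φ τ z) dτ| dm ≤ (q' − q) ∫ |h| dm`. -/
theorem stub_augCurrentFlowTools {E : Type*} [NormedAddCommGroup E] [NormedSpace ℝ E]
    [FiniteDimensional ℝ E] [MeasurableSpace E] [BorelSpace E]
    {V : E → E} (hV : ContDiff ℝ 1 V) (hVc : HasCompactSupport V)
    {Bx : Set E} (hBx : IsCompact Bx) (hVB : tsupport V ⊆ Bx)
    (m : Measure E) [IsFiniteMeasure m] (hmB : m Bxᶜ = 0)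
    (hVm : ∀ ψ : E → ℝ, ContDiff ℝ 1 ψ → HasCompactSupport ψ → ∫ z, fderiv ℝ ψ z (V z) ∂m = 0) :
    ∃ Φ : ℝ → E → E,
      (Continuous fun p : ℝ × E => Φ p.1 p.2) ∧
      (∀ z, Φ 0 z = z) ∧
      (∀ z t, HasDerivAt (fun s => Φ s z) (V (Φ t z)) t) ∧
      (∀ z s t, Φ (s + t) z = Φ s (Φ t z)) ∧
      (∀ z ∈ Bx, ∀ t, Φ t z ∈ Bx) ∧
      (∀ t, 0 ≤ t → m.map (Φ t) = m) ∧
      (∀ h : E → ℝ, Continuous h → Integrable h m) ∧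
      (∀ h : E → ℝ, Continuous h → ∀ q q' : ℝ, Continuous fun z => ∫ τ in q..q', h (Φ τ z)) ∧
      (∀ h : E → ℝ, Continuous h → ∀ q q' : ℝ, 0 ≤ q → q ≤ q' →
        ∫ z, |∫ τ in q..q', h (Φ τ z)| ∂m ≤ (q' - q) * ∫ z, |h z| ∂m) := by
  obtain ⟨K, hK⟩ := hV.lipschitzWith_of_hasCompactSupport hVc one_ne_zero
  set Φ : ℝ → E → E := fun t z => lipschitzFlow hK z t with hΦdef
  have hcont : Continuous fun p : ℝ × E => Φ p.1 p.2 :=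
    (contDiff_lipschitzFlow hV le_rfl hK).continuous.comp continuous_swap
  have h0 : ∀ z, Φ 0 z = z := fun z => lipschitzFlow_zero hK z
  have hder : ∀ z t, HasDerivAt (fun s => Φ s z) (V (Φ t z)) t := fun z t =>
    hasDerivAt_lipschitzFlow hK z t
  have hadd : ∀ z s t, Φ (s + t) z = Φ s (Φ t z) := fun z s t => by
    simp only [hΦdef]
    rw [add_comm, lipschitzFlow_add]
  have hconf : ∀ z ∈ Bx, ∀ t, Φ t z ∈ Bx := fun z hz t => lipschitzFlow_mem_of_mem hK hVB hz t
  have hmeasΦ : ∀ t, Measurable (Φ t) := fun t =>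
    (hcont.comp (continuous_const.prodMk continuous_id)).measurable
  have hinv : ∀ t, 0 ≤ t → m.map (Φ t) = m :=
    map_flow_eq_self_of_forall_integral_fderiv_eq_zero hV (V₀ := univ) (fun z _ => h0 z)
      (fun z _ => (hcont.comp (continuous_id.prodMk continuous_const)).continuousOn)
      (fun z _ t _ => (hder z t).hasDerivWithinAt) (fun z _ s t _ _ => hadd z s t)
      (fun t _ => (hmeasΦ t).aemeasurable) hBx (subset_univ _) hmB hVm
  -- continuous observables are integrable (the measure is carried by the compact `Bx`)
  have hint : ∀ h : E → ℝ, Continuous h → Integrable h m := fun h hh => by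
    obtain ⟨C, hC⟩ := hBx.exists_bound_of_continuousOn hh.continuousOn
    have hae : ∀ᵐ z ∂m, z ∈ Bx := by rw [ae_iff]; exact hmB
    exact Integrable.of_bound hh.aestronglyMeasurable (C := C) (hae.mono fun z hz => hC z hz)
  have hpar : ∀ h : E → ℝ, Continuous h → ∀ q q' : ℝ, Continuous fun z => ∫ τ in q..q', h (Φ τ z) :=
    fun h hh q q' => by
      have hu : Continuous (Function.uncurry fun (z : E) (τ : ℝ) => h (Φ τ z)) :=
        hh.comp (hcont.comp continuous_swap)
      exact intervalIntegral.continuous_parametric_intervalIntegral_of_continuous' hu q q'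
  refine ⟨Φ, hcont, h0, hder, hadd, hconf, hinv, hint, hpar, fun h hh q q' hq hqq' => ?_⟩
  exact integral_abs_intervalIntegral_comp_le hcont.measurable m hinv hh.measurable (hint h hh) hq hqq'

end Summit.AnomalousDissipation.AnomalousDissipation.Theorems.EnsembleRealization
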